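import Literature.NumberTheory.Rogawski1990.LocalTransferSplitPlaceClasses
import Literature.NumberTheory.Rogawski1990.LocalTransferExistence
import HarnessLib

/-!
# The local `Δ`-transfer at a place SPLIT in `L`, pre-assembled: it EXISTS as soon as ONE identity per normalised matching pair holds,
# and that identity is the product of the `H`-side descent, the `G`-side descent and the scalar identity `Δ_v(γ_H, γ₀) · w(p) = ψ(p_M)`

Topic `NumberTheory/Rogawski1990`; namespace `Literature.NumberTheory.Rogawski1990`.  THEOREMS ONLY (no definition, no instance, no notation,
no named fact, no `sorry`).  Cell `pub/hodgecm-mathlib`, programme P3a, road «D-N6s» (the SPLIT-PLACE clause of letter N6 =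
[Rogawski1990, Prop. 4.9.1 (a)]: «`φ_v → φ^H_v` exists at a place `v` of `L⁺` split in `L`»), brick **B5-A «ASSEMBLY», PART 1,
HYPOTHESIS-DRIVEN** (LEAD F0P3a-plan (g8) T7-25 (5); cut F0P3a-p03 (g9) 00:17:44Z).  The assembly of the N6 split clause has three inputs
being typed in parallel — B5-L (the `H`-side: `Φ^st_H(γ_H, φᴴ) = ψ(p_M) · O_{p_M}(CTφ′)`), B5-R (the `G`-side: `Σ_{[γ]} Δ_v Φ([γ], φ) =
w(p) · O_{p_M}(CTφ′)`, Rogawski's Lemma 4.13.1 (a) through ★ `GLnLeviOrbitalDescentCanonicalBochner`) and the scalar identity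
`Δ_v(γ_H, γ₀) · w(p) = ψ(p_M)` (★ `finExplicitDelta_eq_tau_mul_weyl_of_split`, ★ `finWeylRatio_eq_boxAd_of_split`, B6) — and ONE frame,
typed HERE against the tree's fixed tokens (★ `isLocalDeltaTransfer_iff`, ★ `isLocalDeltaTransferExists_iff`, ★ B3
`LocalTransferSplitPlaceClasses`):

* §1 PACKAGING.  **`isLocalDeltaTransfer_of_split_of_forall_pair`** — for ANY local transfer factor `T`, ANY orbital measure families and
  any `fH, f`: if for every `G`-regular `γ_H` and every match `γ₀` NORMALISED by `e′ γ₀ = endoGL(e₂ γ_H.1, e₁ γ_H.2)` (★ `exists_isLocalNormPair_of_split`)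
  `Φ([γ_H], fH) = Δ_v(γ_H, γ₀) · Φ([γ₀], f)`, then `fH` is a `Δ_v`-transfer of `f` (★ B3: the `H`-side stable orbital integral is `Φ([γ_H], ·)`,
  the `G`-side sum is its `[γ₀]`-term); **`isLocalDeltaTransferExists_of_split_of_forall_pair`** — the same for a transfer MAP `φ ↦ φᴴ`
  preserving the test-function classes: `IsLocalDeltaTransferExists`.
* §2 THE GLUE AS ARITHMETIC.  `classOrbital_pair_identity_of_sides` — `OH = ψ O`, `OG = w • O`, `Δ w = ψ` ⊢ `OH = Δ OG`;
  `delta_mul_w_eq_psi` — `Δ = τ D`, `D = d₁ (√d_K)⁻¹`, `τ = χ`, `w = C d₁⁻¹ d_K`, `ψ = C χ √d_K` ⊢ `Δ w = ψ` (the bookkeeping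
  `τ ‖det(1−K)‖ ‖det K‖^{−1∕2} · C ‖det(1−K)‖⁻¹ ‖det K‖ = C χ ‖det K‖^{1∕2}` of Rogawski p. 66: `D_{G∕M}^{1∕2}` against the Jacobian of
  Lemma 4.13.1 (a)); `classOrbital_pair_identity` — their composite.
PART 2 (the instantiation at `φᴴ := (ψ · CTφ′) ∘ j̃`, `T := finExplicitCollection … v`, with B5-L ∕ B5-R ∕ B6 ∕ (A1) BY NAME) is the closing
edition.  HONEST LABEL: HC_CM is proved only modulo the printed citations until rung 0 closes; this file proves none of them.

## References
* [Rogawski1990] J. D. Rogawski, *Automorphic Representations of Unitary Groups in Three Variables*, Ann. of Math. Stud. 123 (1990), §4.3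
  (4.3.1) p. 43, §4.9 Prop. 4.9.1 (a) pp. 54–55, §4.13 Lemma 4.13.1 (a) pp. 64–66, §14.2 p. 232.
* [LanglandsShelstad1987] R. P. Langlands, D. Shelstad, *On the definition of transfer factors*, Math. Ann. 278 (1987), §1.
-/

set_option autoImplicit false

noncomputable section

open NumberField IsDedekindDomain
open scoped Matrix MatrixGroups

namespace Literature.NumberTheory.Rogawski1990

open Literature.NumberTheory.Automorphic Literature.NumberTheory.Automorphic.UnitaryGroup

/-! ## §1 Packaging: one identity per normalised matching pair ⇒ `IsLocalDeltaTransfer` ⇒ `IsLocalDeltaTransferExists` -/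

section CM

variable (L : Type) [Field L] [NumberField L] [IsCMField L] (H' : Matrix (Fin 3) (Fin 3) L)
  {v : HeightOneSpectrum (𝓞 ↥(maximalRealSubfield L))} (hc : IsCMField.complexConj L ≠ 1)
  (w : UnitaryGroup.PlacesOver L v) (hw : IsCMField.complexConj L • w.1 ≠ w.1)
  (hΦ₂ : ((Matrix.of fun i j : Fin 2 => if i.val + j.val + 1 = 2 then (1 : L) else 0).map (IsCMField.complexConj L))ᵀ =
    Matrix.of fun i j : Fin 2 => if i.val + j.val + 1 = 2 then (1 : L) else 0)
  (hΦ₂w : IsUnit (placeForm (Matrix.of fun i j : Fin 2 => if i.val + j.val + 1 = 2 then (1 : L) else 0) w.1))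
  (hΦ₁ : ((Matrix.of fun i j : Fin 1 => if i.val + j.val + 1 = 1 then (1 : L) else 0).map (IsCMField.complexConj L))ᵀ =
    Matrix.of fun i j : Fin 1 => if i.val + j.val + 1 = 1 then (1 : L) else 0)
  (hΦ₁w : IsUnit (placeForm (Matrix.of fun i j : Fin 1 => if i.val + j.val + 1 = 1 then (1 : L) else 0) w.1))
  (hH' : (H'.map (IsCMField.complexConj L))ᵀ = H') (hH'w : IsUnit (placeForm H' w.1))

/-- **`φ^H` is a `Δ_v`-transfer of `φ` at a split place as soon as ONE identity per normalised matching pair holds.**  For ANY local transfer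
factor `T` (★ `LocalTransferFactor`), ANY orbital measure families `mH`, `mG` and any `fH`, `f`: if for every `G`-regular `γ_H ∈ H_v` and every
`γ₀ ∈ G′_v` matching `γ_H` with `e′ γ₀ = endoGL(e₂ γ_H.1, e₁ γ_H.2)` one has `Φ([γ_H], fH) = Δ_v(γ_H, γ₀) · Φ([γ₀], f)`, then (4.3.1) holds:
its left side is `Φ([γ_H], fH)` (★ `stableOrbitalIntegralRel_isLocalStablyConjH_eq_of_split`), its right side is the single term at `[γ₀]`
(★ `finsum_delta_mul_classOrbitalIntegral_eq_of_split`), and such a `γ₀` exists (★ `exists_isLocalNormPair_of_split`).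
[cite: Rogawski1990, §4.3 (4.3.1) p. 43; §4.9 p. 54; §14.2 p. 232] -/
theorem isLocalDeltaTransfer_of_split_of_forall_pair
    (hΦ₂' : ((Matrix.of fun i j : Fin 2 => if i.val + j.val + 1 = 2 then (1 : L) else 0).map (cmConjRingHom L))ᵀ =
      Matrix.of fun i j : Fin 2 => if i.val + j.val + 1 = 2 then (1 : L) else 0)
    (hΦ₂d : (Matrix.of fun i j : Fin 2 => if i.val + j.val + 1 = 2 then (1 : L) else 0).det ≠ 0)
    (hΦ₁' : ((Matrix.of fun i j : Fin 1 => if i.val + j.val + 1 = 1 then (1 : L) else 0).map (cmConjRingHom L))ᵀ =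
      Matrix.of fun i j : Fin 1 => if i.val + j.val + 1 = 1 then (1 : L) else 0)
    (hΦ₁d : (Matrix.of fun i j : Fin 1 => if i.val + j.val + 1 = 1 then (1 : L) else 0).det ≠ 0)
    {_ha : ∀ a : ((UnitaryGroup.cmDatum L 2 (Matrix.of fun i j : Fin 2 => if i.val + j.val + 1 = 2 then (1 : L) else 0)).Local v ×
        (UnitaryGroup.cmDatum L 1 (Matrix.of fun i j : Fin 1 => if i.val + j.val + 1 = 1 then (1 : L) else 0)).Local v),
      MeasurableSpace (((UnitaryGroup.cmDatum L 2 (Matrix.of fun i j : Fin 2 => if i.val + j.val + 1 = 2 then (1 : L) else 0)).Local v ×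
        (UnitaryGroup.cmDatum L 1 (Matrix.of fun i j : Fin 1 => if i.val + j.val + 1 = 1 then (1 : L) else 0)).Local v) ⧸
        Subgroup.centralizer ({a} : Set ((UnitaryGroup.cmDatum L 2 (Matrix.of fun i j : Fin 2 => if i.val + j.val + 1 = 2 then (1 : L) else 0)).Local v ×
        (UnitaryGroup.cmDatum L 1 (Matrix.of fun i j : Fin 1 => if i.val + j.val + 1 = 1 then (1 : L) else 0)).Local v)))}
    {_hγ : ∀ γ : (UnitaryGroup.cmDatum L 3 H').Local v,
      MeasurableSpace ((UnitaryGroup.cmDatum L 3 H').Local v ⧸ Subgroup.centralizer ({γ} : Set ((UnitaryGroup.cmDatum L 3 H').Local v)))}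
    (T : LocalTransferFactor L H' v)
    (mH : OrbitalMeasureFamily ((UnitaryGroup.cmDatum L 2 (Matrix.of fun i j : Fin 2 => if i.val + j.val + 1 = 2 then (1 : L) else 0)).Local v ×
        (UnitaryGroup.cmDatum L 1 (Matrix.of fun i j : Fin 1 => if i.val + j.val + 1 = 1 then (1 : L) else 0)).Local v))
    (mG : OrbitalMeasureFamily ((UnitaryGroup.cmDatum L 3 H').Local v))
    (fH : ((UnitaryGroup.cmDatum L 2 (Matrix.of fun i j : Fin 2 => if i.val + j.val + 1 = 2 then (1 : L) else 0)).Local v ×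
        (UnitaryGroup.cmDatum L 1 (Matrix.of fun i j : Fin 1 => if i.val + j.val + 1 = 1 then (1 : L) else 0)).Local v) → ℂ)
    (f : (UnitaryGroup.cmDatum L 3 H').Local v → ℂ)
    (hpair : ∀ γH : ((UnitaryGroup.cmDatum L 2 (Matrix.of fun i j : Fin 2 => if i.val + j.val + 1 = 2 then (1 : L) else 0)).Local v ×
        (UnitaryGroup.cmDatum L 1 (Matrix.of fun i j : Fin 1 => if i.val + j.val + 1 = 1 then (1 : L) else 0)).Local v),
      IsLocalGRegular L v γH → ∀ γ₀ : (UnitaryGroup.cmDatum L 3 H').Local v, IsLocalNormPair L H' v γH γ₀ →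
        localSplitEquiv (IsCMField.complexConj L) H' hc hH' w hw hH'w γ₀ =
          endoGL (localSplitEquiv (IsCMField.complexConj L) _ hc hΦ₂ w hw hΦ₂w γH.1,
            localSplitEquiv (IsCMField.complexConj L) _ hc hΦ₁ w hw hΦ₁w γH.2) →
        classOrbitalIntegral mH fH (ConjClasses.mk γH) = T.Δ γH γ₀ * classOrbitalIntegral mG f (ConjClasses.mk γ₀)) :
    IsLocalDeltaTransfer L H' v T mH mG fH f := by
  rw [isLocalDeltaTransfer_iff]
  intro γH hreg
  obtain ⟨γ₀, h₀, he⟩ := exists_isLocalNormPair_of_split L H' hc w hw hΦ₂ hΦ₂w hΦ₁ hΦ₁w hH' hH'w γH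
  rw [stableOrbitalIntegralRel_isLocalStablyConjH_eq_of_split L w hw hΦ₂' hΦ₂d hΦ₁' hΦ₁d mH fH γH,
    finsum_delta_mul_classOrbitalIntegral_eq_of_split L H' hH' w hw hH'w T mG f h₀]
  exact hpair γH hreg γ₀ h₀ he

/-- **`φ ↦ φᴴ` realises the local `Δ`-transfer at a split place** ([Rogawski1990, Prop. 4.9.1 (a)], split clause, PRE-ASSEMBLED): for ANY
`T`, families `mH`, `mG`, test-function classes `Smooth′` on `G′_v`, `SmoothH` on `H_v`, and any map `transfer : φ ↦ φᴴ` with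
`SmoothH (transfer φ)` for `Smooth′ φ`, if every such `φ` satisfies the per-pair identity of `isLocalDeltaTransfer_of_split_of_forall_pair`
with `fH := transfer φ`, then `IsLocalDeltaTransferExists L H′ v T mH mG Smooth′ SmoothH`.  In the N6 assembly `transfer φ := (ψ · CTφ′) ∘ j̃`
(constant term along `U_{(2,1)}` of `φ′ = φ ∘ e′⁻¹`, weighted by `ψ = C · χ · ‖det K‖^{1∕2}`, pulled back to `H_v ≅ GL₂ × GL₁ ≅ M_{(2,1)}`).
[cite: Rogawski1990, §4.9 Prop. 4.9.1 (a) pp. 54–55; §4.13 Lemma 4.13.1 (a) pp. 64–66] [cite: LanglandsShelstad1987, §1] -/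
theorem isLocalDeltaTransferExists_of_split_of_forall_pair
    (hΦ₂' : ((Matrix.of fun i j : Fin 2 => if i.val + j.val + 1 = 2 then (1 : L) else 0).map (cmConjRingHom L))ᵀ =
      Matrix.of fun i j : Fin 2 => if i.val + j.val + 1 = 2 then (1 : L) else 0)
    (hΦ₂d : (Matrix.of fun i j : Fin 2 => if i.val + j.val + 1 = 2 then (1 : L) else 0).det ≠ 0)
    (hΦ₁' : ((Matrix.of fun i j : Fin 1 => if i.val + j.val + 1 = 1 then (1 : L) else 0).map (cmConjRingHom L))ᵀ =
      Matrix.of fun i j : Fin 1 => if i.val + j.val + 1 = 1 then (1 : L) else 0)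
    (hΦ₁d : (Matrix.of fun i j : Fin 1 => if i.val + j.val + 1 = 1 then (1 : L) else 0).det ≠ 0)
    {_ha : ∀ a : ((UnitaryGroup.cmDatum L 2 (Matrix.of fun i j : Fin 2 => if i.val + j.val + 1 = 2 then (1 : L) else 0)).Local v ×
        (UnitaryGroup.cmDatum L 1 (Matrix.of fun i j : Fin 1 => if i.val + j.val + 1 = 1 then (1 : L) else 0)).Local v),
      MeasurableSpace (((UnitaryGroup.cmDatum L 2 (Matrix.of fun i j : Fin 2 => if i.val + j.val + 1 = 2 then (1 : L) else 0)).Local v ×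
        (UnitaryGroup.cmDatum L 1 (Matrix.of fun i j : Fin 1 => if i.val + j.val + 1 = 1 then (1 : L) else 0)).Local v) ⧸
        Subgroup.centralizer ({a} : Set ((UnitaryGroup.cmDatum L 2 (Matrix.of fun i j : Fin 2 => if i.val + j.val + 1 = 2 then (1 : L) else 0)).Local v ×
        (UnitaryGroup.cmDatum L 1 (Matrix.of fun i j : Fin 1 => if i.val + j.val + 1 = 1 then (1 : L) else 0)).Local v)))}
    {_hγ : ∀ γ : (UnitaryGroup.cmDatum L 3 H').Local v,
      MeasurableSpace ((UnitaryGroup.cmDatum L 3 H').Local v ⧸ Subgroup.centralizer ({γ} : Set ((UnitaryGroup.cmDatum L 3 H').Local v)))}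
    (T : LocalTransferFactor L H' v)
    (mH : OrbitalMeasureFamily ((UnitaryGroup.cmDatum L 2 (Matrix.of fun i j : Fin 2 => if i.val + j.val + 1 = 2 then (1 : L) else 0)).Local v ×
        (UnitaryGroup.cmDatum L 1 (Matrix.of fun i j : Fin 1 => if i.val + j.val + 1 = 1 then (1 : L) else 0)).Local v))
    (mG : OrbitalMeasureFamily ((UnitaryGroup.cmDatum L 3 H').Local v))
    (Smooth' : ((UnitaryGroup.cmDatum L 3 H').Local v → ℂ) → Prop)
    (SmoothH : (((UnitaryGroup.cmDatum L 2 (Matrix.of fun i j : Fin 2 => if i.val + j.val + 1 = 2 then (1 : L) else 0)).Local v ×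
        (UnitaryGroup.cmDatum L 1 (Matrix.of fun i j : Fin 1 => if i.val + j.val + 1 = 1 then (1 : L) else 0)).Local v) → ℂ) → Prop)
    (transfer : ((UnitaryGroup.cmDatum L 3 H').Local v → ℂ) →
      (((UnitaryGroup.cmDatum L 2 (Matrix.of fun i j : Fin 2 => if i.val + j.val + 1 = 2 then (1 : L) else 0)).Local v ×
        (UnitaryGroup.cmDatum L 1 (Matrix.of fun i j : Fin 1 => if i.val + j.val + 1 = 1 then (1 : L) else 0)).Local v) → ℂ))
    (hsmooth : ∀ φ, Smooth' φ → SmoothH (transfer φ))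
    (hpair : ∀ φ, Smooth' φ →
      ∀ γH : ((UnitaryGroup.cmDatum L 2 (Matrix.of fun i j : Fin 2 => if i.val + j.val + 1 = 2 then (1 : L) else 0)).Local v ×
        (UnitaryGroup.cmDatum L 1 (Matrix.of fun i j : Fin 1 => if i.val + j.val + 1 = 1 then (1 : L) else 0)).Local v),
      IsLocalGRegular L v γH → ∀ γ₀ : (UnitaryGroup.cmDatum L 3 H').Local v, IsLocalNormPair L H' v γH γ₀ →
        localSplitEquiv (IsCMField.complexConj L) H' hc hH' w hw hH'w γ₀ =
          endoGL (localSplitEquiv (IsCMField.complexConj L) _ hc hΦ₂ w hw hΦ₂w γH.1,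
            localSplitEquiv (IsCMField.complexConj L) _ hc hΦ₁ w hw hΦ₁w γH.2) →
        classOrbitalIntegral mH (transfer φ) (ConjClasses.mk γH) = T.Δ γH γ₀ * classOrbitalIntegral mG φ (ConjClasses.mk γ₀)) :
    IsLocalDeltaTransferExists L H' v T mH mG Smooth' SmoothH := by
  rw [isLocalDeltaTransferExists_iff]
  intro φ hφ
  exact ⟨transfer φ, hsmooth φ hφ,
    isLocalDeltaTransfer_of_split_of_forall_pair L H' hc w hw hΦ₂ hΦ₂w hΦ₁ hΦ₁w hH' hH'w hΦ₂' hΦ₂d hΦ₁' hΦ₁d T mH mG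
      (transfer φ) φ (hpair φ hφ)⟩

end CM

/-! ## §2 The glue as arithmetic -/

section Glue

/-- **The per-pair identity from its two sides**: if the `H`-side reads `OH = ψ · O` (B5-L: `Φ([γ_H], φᴴ) = ψ(p_M) · O_{p_M}(CTφ′)`), the
`G`-side reads `OG = w • O` (B5-R: `Φ([γ₀], φ) = w(p).toReal • O_{p_M}(CTφ′)`, the SAME canonical orbital integral `O` on `M ⧸ C_M(p_M)`),
and the scalar identity `Δ · w = ψ` holds, then `OH = Δ · OG`. [cite: Rogawski1990, §4.13 Lemma 4.13.1 (a) pp. 64–66; §4.9 p. 55] -/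
theorem classOrbital_pair_identity_of_sides {OH OG O Δ ψ : ℂ} {wp : ℝ} (hL : OH = ψ * O) (hR : OG = wp • O)
    (hA2 : Δ * (wp : ℂ) = ψ) : OH = Δ * OG := by
  rw [hL, hR, Complex.real_smul, ← mul_assoc, hA2]

/-- **The scalar identity `Δ_v(γ_H, γ₀) · w(p) = ψ(p_M)` as bookkeeping.**  Inputs as equalities of numbers: `Δ = τ · D` (★
`finExplicitDelta_eq_tau_mul_weyl_of_split`: at a split place `Δ‴_v = τ_v · D_{G∕H,v}`), `D = d₁ · (√d_K)⁻¹` with `d₁ = ‖det(1 − K_p)‖`,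
`d_K = ‖det K_p‖` (★ `finWeylRatio_eq_boxAd_of_split`), `τ = χ` (B6: `τ_v(γ_H) = μ_w(det g_w)` read on `M`), `w = C · d₁⁻¹ · d_K` (the constant of
★ `exists_integral_descConj_quotientMeasure_eq_smul_integral_levi`, Lemma 4.13.1 (a)), `ψ = C · χ · √d_K` (the weight of `φᴴ`).  Then
`Δ · w = ψ`. [cite: Rogawski1990, §4.13 Lemma 4.13.1 (a) pp. 64–66; §4.9 p. 55] -/
theorem delta_mul_w_eq_psi {Δ τ χ ψ : ℂ} {D d₁ dK C wp : ℝ} (hΔ : Δ = τ * (D : ℂ)) (hD : D = d₁ * (Real.sqrt dK)⁻¹)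
    (hτ : τ = χ) (hw : wp = C * d₁⁻¹ * dK) (hψ : ψ = (C : ℂ) * χ * (Real.sqrt dK : ℂ)) (hd₁ : d₁ ≠ 0) (hdK : 0 < dK) :
    Δ * (wp : ℂ) = ψ := by
  have hs : Real.sqrt dK ≠ 0 := (Real.sqrt_pos.2 hdK).ne'
  have hsq : (Real.sqrt dK : ℂ) * (Real.sqrt dK : ℂ) = (dK : ℂ) := by
    rw [← Complex.ofReal_mul, Real.mul_self_sqrt hdK.le]
  rw [hΔ, hD, hτ, hw, hψ]
  have hd₁' : (d₁ : ℂ) ≠ 0 := Complex.ofReal_ne_zero.2 hd₁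
  have hs' : (Real.sqrt dK : ℂ) ≠ 0 := Complex.ofReal_ne_zero.2 hs
  push_cast
  rw [← hsq]
  field_simp

/-- **The per-pair identity, assembled** from the `H`-side, the `G`-side and the five scalar inputs of `delta_mul_w_eq_psi`.
[cite: Rogawski1990, §4.13 Lemma 4.13.1 (a) pp. 64–66; §4.9 Prop. 4.9.1 (a) p. 55] -/
theorem classOrbital_pair_identity {OH OG O Δ τ χ ψ : ℂ} {D d₁ dK C wp : ℝ} (hL : OH = ψ * O) (hR : OG = wp • O)
    (hΔ : Δ = τ * (D : ℂ)) (hD : D = d₁ * (Real.sqrt dK)⁻¹) (hτ : τ = χ) (hw : wp = C * d₁⁻¹ * dK)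
    (hψ : ψ = (C : ℂ) * χ * (Real.sqrt dK : ℂ)) (hd₁ : d₁ ≠ 0) (hdK : 0 < dK) : OH = Δ * OG :=
  classOrbital_pair_identity_of_sides hL hR (delta_mul_w_eq_psi hΔ hD hτ hw hψ hd₁ hdK)

end Glue

end Literature.NumberTheory.Rogawski1990

end
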